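/-
Speedrun cell sr-mbsolver / programme hubbard-alg — LIT team (lit-1 gen-26): THEOREM B, `jw-srot` form, for the RAWLOW relaxation with raw block
`ρ₅` AND STAGGERED CHARGE COMPONENTS (FORMAT-ksdn v0.5 `mps-rawlow` + v0.6 'staggered charge components', the χ12 two-label `nszb5` tensors of
CERTIFIED #494 (U = 2) / #495 (U = 1): `m₀ = 6`, injection `W₄` (rank 144), bound rule `lmax_psd`, bond labels a PAIR (additive occupation charge
with FIVE N-sectors, staggered spin charge with the involutive bond rule)) — the kernel edge between the BY-VALUE node of such a row and the window
level. Theorem-only: `ksdnSrotNszbClaim_of_mpsRaw5SrotNszbTrClaim` = `ksdnSrotNszbClaim_of_mpsRaw6SrotTrClaim` (`Transport/MPSPrimalRaw6SrotNszb.lean`,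
lit-1 g18) VERBATIM with the raw head block `ρ₆` on `{-1,…,4}` replaced by `ρ₅` on `{-1,…,3}` (coordinates `e₅ : Fin 5 ≃ {-1,…,3}`, `i ↦ i − 1`, the
window lemmas of `Transport/MPSPrimalRaw5Srot.lean`), the injection `W₅` by `W₄ = cgMap A 4`, the compressed levels by `ω₆…ω_N` (chain rows from
`m = 7`) — i.e. the geometry of `ksdnSrotClaim_of_mpsRaw5SrotTrClaim` (lit-1 g15) with the SITE-INDEXED PAIR charges `qs : ℕ → Fin 4 → ℤ × ℤ`,
`qb : ℕ → β → ℤ × ℤ` (`A^s_{ab} ≠ 0 ⇒ qb (x+1) b = qb x a + qs x s`, `qs x s = (cb·|occ s| − ca, (−1)^x · cm · ([↑ ∈ occ s] − [↓ ∈ occ s]))`), the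
`ω`-sector tags `cgTagAt qs qb 0 (m−2)` and the extra STAGGERED-spin block-diagonality hypothesis on both the by-value statement (`ρ₅`) and the
concluded window statement (`ρ`) of the ρ₆ theorem. The feasible point is `exists_mpsRawRowsTr_of_window_loewner_at 4`
(`Transport/MPSPrimalRawWindowAt.lean`). Window `N = n + 3 ≥ 6`. CONCLUSION = the hypothesis `hclaim` of `Transport.ksdnClaim_of_srotNszbClaim` on
`{-1, …, n+1}` with density `ν`. No model beyond `jw-srot`, no definition, no `sorry`, no new axiom, no named fact.
HONEST FRAMING: first certified bounds; not a superconductivity verdict; every number certified or labelled float.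
[cite: KullEtAl2024, §2.3–2.5, §3.3, §4.2, §6.2] [cite: ArakiMoriya2003, §4.1] [cite: PerezGarciaVerstraeteWolfCirac2007, §3.2]
-/
import Summits.Ventures.CertifiedManyBodySolver.Transport.MPSPrimalRawWindowAt
import Summits.Ventures.CertifiedManyBodySolver.Transport.MPSPrimalRaw5Srot
import HarnessLib

noncomputable section

open Matrix Complex Filter Topology
open scoped ComplexOrder Kronecker BigOperators MatrixOrder
open Literature.Probability.LatticeModels
open Literature.MathematicalPhysics.QuantumLattice
open Literature.MathematicalPhysics.QuantumLattice.HubbardWave0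
open Literature.MathematicalPhysics.QuantumLattice.ThermodynamicLimit
open Literature.MathematicalPhysics.QuantumLattice.JordanWigner
open Literature.MathematicalPhysics.QuantumManyBody.StateRelaxation
open Literature.MathematicalPhysics.QuantumLattice.MPSCoarseGraining
open Literature.Computability.QuantumComplexity (traceLeft traceRight)

namespace Summit.Ventures.CertifiedManyBodySolver.Transport

/-! ### THEOREM B, `jw-srot` form, RAWLOW with raw block `ρ₅` and staggered-spin sectors: the `mps-rawlow(N, D, A)` statement implies the `jw-srot` window statement with staggered sectors -/

section Transport

variable {β : Type*} [Fintype β] [DecidableEq β]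

/-- **THEOREM B, `jw-srot` form, RAWLOW with raw block `ρ₅`, `W₄`, `λ_max` bounds AND STAGGERED-SPIN SECTORS, edge form.** Data: window
`N = n+3 ≥ 6` sites; a REAL MPS tensor `A = (A^s)_{s ∈ Fin 4}` on the bond index type `β`, covariant for the SITE-INDEXED PAIR charges
`qs x s = (cb·|occ(s)| − ca, (−1)^x·cm·([↑ ∈ occ s] − [↓ ∈ occ s]))` with bond charges `qb : ℕ → β → ℤ × ℤ`; a-priori bounds `B_m ≥ 0` with
`W_{m−2}ᴴW_{m−2} ≤ B_m·𝟙` (`m = k+6 ≤ N`); coordinates `e₅ : Fin 5 ≃ {-1,…,3}`, `i ↦ i − 1`. HYPOTHESIS `hclaim` = the by-value node of a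
`hubbard_jwsrot` `mps-rawlow` row with staggered charge components: over `ρ₅ : Op (PolySite {-1,…,3}) 4` and `ω₆, …, ω_N` — `ρ₅ ⪰ 0`,
`tr ρ₅ = 1`, LTI `tr_{-1} ρ₅ = tr_{3} ρ₅`, TOTAL-OCCUPATION sector zeros, STAGGERED-SPIN sector zeros, total density of site `-1` equal to `ν`,
real entries, `|ρ₅| ≤ 1`; E6L/E6R with `ρ₅` read through `e₅` then as (first four, last) / (first, last four) and `W₄ = cgMap A 4`; E_mL/E_mR
(`m = k+7 ≤ N`); `ω_m ⪰ 0`, `cgTagAt qs qb 0 (m−2)` sectors, real, `|ω_m| ≤ B_m`, `Re tr ω_m ≤ B_m` (`m = k+6 ≤ N`); conclusion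
`E ≤ Re tr(toSpin(U n_{-1↑}n_{-1↓} − t Σ_σ (c†_{-1σ} c_{0σ̄} + c†_{0σ̄} c_{-1σ})) ρ₅)`. CONCLUSION: the hypothesis `hclaim` of
`Transport.ksdnClaim_of_srotNszbClaim` on `{-1, …, n+1}` with density `ν` (the `jw-srot` window statement with staggered-spin sectors).
[cite: KullEtAl2024, §2.3–2.5, §3.3, §4.2, §6.2] [cite: ArakiMoriya2003, §4.1] -/
theorem ksdnSrotNszbClaim_of_mpsRaw5SrotNszbTrClaim (t U : ℝ) (n : ℕ) (hn : 3 ≤ n) (A : Fin 4 → Matrix β β ℂ)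
    (hAreal : ∀ s a b, star (A s a b) = A s a b) (qs : ℕ → Fin 4 → ℤ × ℤ) (qb : ℕ → β → ℤ × ℤ) (cb ca cm : ℤ)
    (hqs : ∀ x s, qs x s = (cb * ((siteOcc s).card : ℤ) - ca,
      (-1 : ℤ) ^ x * cm * ((if (0 : Fin 2) ∈ siteOcc s then 1 else 0 : ℤ) - (if (1 : Fin 2) ∈ siteOcc s then 1 else 0 : ℤ))))
    (hAcov : ∀ x s a b, A s a b ≠ 0 → qb (x + 1) b = qb x a + qs x s)
    (B : ℕ → ℝ) (hB : ∀ k, k + 6 ≤ n + 3 → 0 ≤ B (k + 6) ∧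
      (cgMap A (k + 4))ᴴ * cgMap A (k + 4) ≤ B (k + 6) • (1 : Matrix (Fin (k + 4) → Fin 4) (Fin (k + 4) → Fin 4) ℂ))
    (e₅ : Fin 5 ≃ PolySite (chainWindow (-1) 3)) (he₅ : ∀ i, ofLex (e₅ i).1 0 = ((i : ℕ) : ℤ) - 1)
    {ν E : ℝ}
    (hclaim : ∀ (ρ₅ : Op (PolySite (chainWindow (-1) 3)) 4)
        (ω : ℕ → Matrix (Fin 4 × ((β × β) × Fin 4)) (Fin 4 × ((β × β) × Fin 4)) ℂ),
      ρ₅.PosSemidef → ρ₅.trace = 1 →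
      spinPartialTrace ((PolySite.affEmb 1 (unitVec 0) (chainWindow (-1) 2)).trans
          (PolySite.incl affShiftSet_chainWindow_two_subset_three)) ρ₅ =
        spinPartialTrace (PolySite.incl chainWindow_two_subset_three) ρ₅ →
      (∀ k k' : TensorIndex (PolySite (chainWindow (-1) 3)) 4,
        (∑ x, (siteOcc (k x)).card) ≠ (∑ x, (siteOcc (k' x)).card) → ρ₅ k k' = 0) →
      (∀ k k' : TensorIndex (PolySite (chainWindow (-1) 3)) 4,
        (∑ y : PolySite (chainWindow (-1) 3), (if Odd (ofLex y.1 0) then (-1 : ℤ) else 1) *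
            ((if (0 : Fin 2) ∈ siteOcc (k y) then 1 else 0 : ℤ) - (if (1 : Fin 2) ∈ siteOcc (k y) then 1 else 0 : ℤ))) ≠
          (∑ y : PolySite (chainWindow (-1) 3), (if Odd (ofLex y.1 0) then (-1 : ℤ) else 1) *
            ((if (0 : Fin 2) ∈ siteOcc (k' y) then 1 else 0 : ℤ) - (if (1 : Fin 2) ∈ siteOcc (k' y) then 1 else 0 : ℤ))) →
        ρ₅ k k' = 0) →
      ((toSpin (nAt (-unitVec 0) neg_unitVec_mem_chainWindow_three 0 +
          nAt (-unitVec 0) neg_unitVec_mem_chainWindow_three 1) * ρ₅).trace).re = ν →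
      (∀ k k' : TensorIndex (PolySite (chainWindow (-1) 3)) 4, starRingEnd ℂ (ρ₅ k k') = ρ₅ k k') →
      (∀ k k' : TensorIndex (PolySite (chainWindow (-1) 3)) 4, ‖ρ₅ k k'‖ ≤ 1) →
      traceLeft (ω 6) = (cgMap A 4 ⊗ₖ (1 : Matrix (Fin 4) (Fin 4) ℂ)) *
          (ρ₅.submatrix (Equiv.arrowCongr e₅ (Equiv.refl (Fin 4))) (Equiv.arrowCongr e₅ (Equiv.refl (Fin 4)))).submatrix
            ((Equiv.prodComm _ _).trans (Fin.snocEquiv fun _ => Fin 4))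
            ((Equiv.prodComm _ _).trans (Fin.snocEquiv fun _ => Fin 4)) *
        (cgMap A 4 ⊗ₖ (1 : Matrix (Fin 4) (Fin 4) ℂ))ᴴ →
      traceRight ((ω 6).submatrix (Equiv.prodAssoc _ _ _) (Equiv.prodAssoc _ _ _)) =
        ((1 : Matrix (Fin 4) (Fin 4) ℂ) ⊗ₖ cgMap A 4) *
          (ρ₅.submatrix (Equiv.arrowCongr e₅ (Equiv.refl (Fin 4))) (Equiv.arrowCongr e₅ (Equiv.refl (Fin 4)))).submatrix
            (Fin.consEquiv fun _ => Fin 4) (Fin.consEquiv fun _ => Fin 4) *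
        ((1 : Matrix (Fin 4) (Fin 4) ℂ) ⊗ₖ cgMap A 4)ᴴ →
      (∀ k, k + 7 ≤ n + 3 → traceLeft (ω (k + 7)) =
        (leftMap A ⊗ₖ (1 : Matrix (Fin 4) (Fin 4) ℂ)) *
          (ω (k + 6)).submatrix (Equiv.prodAssoc _ _ _) (Equiv.prodAssoc _ _ _) *
        (leftMap A ⊗ₖ (1 : Matrix (Fin 4) (Fin 4) ℂ))ᴴ) →
      (∀ k, k + 7 ≤ n + 3 → traceRight ((ω (k + 7)).submatrix (Equiv.prodAssoc _ _ _) (Equiv.prodAssoc _ _ _)) =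
        ((1 : Matrix (Fin 4) (Fin 4) ℂ) ⊗ₖ rightMap A) * ω (k + 6) *
        ((1 : Matrix (Fin 4) (Fin 4) ℂ) ⊗ₖ rightMap A)ᴴ) →
      (∀ k, k + 6 ≤ n + 3 → (ω (k + 6)).PosSemidef) →
      (∀ k, k + 6 ≤ n + 3 → ∀ i j, cgTagAt qs qb 0 (k + 4) i ≠ cgTagAt qs qb 0 (k + 4) j → ω (k + 6) i j = 0) →
      (∀ k, k + 6 ≤ n + 3 → ∀ i j, starRingEnd ℂ (ω (k + 6) i j) = ω (k + 6) i j) →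
      (∀ k, k + 6 ≤ n + 3 → ∀ i j, ‖ω (k + 6) i j‖ ≤ B (k + 6)) →
      (∀ k, k + 6 ≤ n + 3 → ((ω (k + 6)).trace).re ≤ B (k + 6)) →
      E ≤ ((toSpin ((U : ℂ) • (nAt (-unitVec 0) neg_unitVec_mem_chainWindow_three 0 *
            nAt (-unitVec 0) neg_unitVec_mem_chainWindow_three 1) +
          (-(t : ℂ)) • ∑ σ : Fin 2,
            ((cAt (-unitVec 0) neg_unitVec_mem_chainWindow_three σ)ᴴ *
                cAt 0 zero_mem_chainWindow_three σ.rev +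
              (cAt 0 zero_mem_chainWindow_three σ.rev)ᴴ *
                cAt (-unitVec 0) neg_unitVec_mem_chainWindow_three σ)) * ρ₅).trace).re) :
    ∀ ρ : Op (PolySite (chainWindow (-1) ((n : ℤ) + 1))) 4, ρ.PosSemidef → ρ.trace = 1 →
      spinPartialTrace ((PolySite.affEmb 1 (unitVec 0) (chainWindow (-1) (n : ℤ))).trans
          (PolySite.incl (affShiftSet_chainWindow_subset (-1) (n : ℤ)))) ρ =
        spinPartialTrace (PolySite.incl (chainWindow_mono_right (-1) (by omega : (n : ℤ) ≤ n + 1))) ρ →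
      (∀ k k' : TensorIndex (PolySite (chainWindow (-1) ((n : ℤ) + 1))) 4,
        (∑ x, (siteOcc (k x)).card) ≠ (∑ x, (siteOcc (k' x)).card) → ρ k k' = 0) →
      (∀ k k' : TensorIndex (PolySite (chainWindow (-1) ((n : ℤ) + 1))) 4,
        (∑ y : PolySite (chainWindow (-1) ((n : ℤ) + 1)), (if Odd (ofLex y.1 0) then (-1 : ℤ) else 1) *
            ((if (0 : Fin 2) ∈ siteOcc (k y) then 1 else 0 : ℤ) - (if (1 : Fin 2) ∈ siteOcc (k y) then 1 else 0 : ℤ))) ≠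
          (∑ y : PolySite (chainWindow (-1) ((n : ℤ) + 1)), (if Odd (ofLex y.1 0) then (-1 : ℤ) else 1) *
            ((if (0 : Fin 2) ∈ siteOcc (k' y) then 1 else 0 : ℤ) - (if (1 : Fin 2) ∈ siteOcc (k' y) then 1 else 0 : ℤ))) →
        ρ k k' = 0) →
      ((toSpin (nAt (-unitVec 0) (neg_unitVec_mem_chainWindow (by omega : (-1 : ℤ) ≤ n + 1)) 0 +
          nAt (-unitVec 0) (neg_unitVec_mem_chainWindow (by omega : (-1 : ℤ) ≤ n + 1)) 1) * ρ).trace).re = ν →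
      (∀ k k' : TensorIndex (PolySite (chainWindow (-1) ((n : ℤ) + 1))) 4, starRingEnd ℂ (ρ k k') = ρ k k') →
      (∀ k k' : TensorIndex (PolySite (chainWindow (-1) ((n : ℤ) + 1))) 4, ‖ρ k k'‖ ≤ 1) →
      E ≤ ((toSpin ((U : ℂ) • (nAt (-unitVec 0) (neg_unitVec_mem_chainWindow (by omega : (-1 : ℤ) ≤ n + 1)) 0 *
            nAt (-unitVec 0) (neg_unitVec_mem_chainWindow (by omega : (-1 : ℤ) ≤ n + 1)) 1) +
          (-(t : ℂ)) • ∑ σ : Fin 2,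
            ((cAt (-unitVec 0) (neg_unitVec_mem_chainWindow (by omega : (-1 : ℤ) ≤ n + 1)) σ)ᴴ *
                cAt 0 (zero_mem_chainWindow (by omega : (0 : ℤ) ≤ n + 1)) σ.rev +
              (cAt 0 (zero_mem_chainWindow (by omega : (0 : ℤ) ≤ n + 1)) σ.rev)ᴴ *
                cAt (-unitVec 0) (neg_unitVec_mem_chainWindow (by omega : (-1 : ℤ) ≤ n + 1)) σ)) * ρ).trace).re := by
  intro ρ hpsd htr hLTI hsec hstag hdens hreal _hbd
  classical
  -- the windows `W₅ = {-1,…,3} ⊆ W = {-1,…,n+1}` and the shifts of the LTI embeddings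
  have hW5 : chainWindow (-1) 3 ⊆ chainWindow (-1) ((n : ℤ) + 1) := chainWindow_mono_right (-1) (by omega)
  have hlow5 : IsLowerSet (Set.range (PolySite.incl hW5)) := isLowerSet_range_incl_chainWindow hW5
  have hφ₀ := shift_incl (chainWindow_mono_right (-1) (by omega : (n : ℤ) ≤ n + 1))
  have hφ₁ : ∀ y, ofLex (((PolySite.affEmb 1 (unitVec 0) (chainWindow (-1) (n : ℤ))).trans
      (PolySite.incl (affShiftSet_chainWindow_subset (-1) (n : ℤ)))) y).1 0 = ofLex y.1 0 + 1 := fun y => by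
    rw [shift_affEmb_trans_incl, chain_unitVec_apply_zero]
  -- (i) coordinates and the relabelled window variable `ρ^F`
  obtain ⟨eN, heN⟩ := exists_finEquiv_chainWindow (n + 3) ((n : ℤ) + 1) (by push_cast; ring)
  obtain ⟨e', he'⟩ := exists_finEquiv_chainWindow (n + 2) (n : ℤ) (by push_cast; ring)
  set ρF : Op (Fin (n + 3)) 4 := spinPartialTrace eN.toEmbedding ρ with hρFdef
  have hFpsd : ρF.PosSemidef := posSemidef_spinPartialTrace _ hpsd
  have hFtr : ρF.trace = 1 := by rw [hρFdef, trace_spinPartialTrace, htr]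
  have hsucc : (Fin.succEmb (n + 2)).trans eN.toEmbedding =
      e'.toEmbedding.trans ((PolySite.affEmb 1 (unitVec 0) (chainWindow (-1) (n : ℤ))).trans
        (PolySite.incl (affShiftSet_chainWindow_subset (-1) (n : ℤ)))) := by
    refine embedding_eq_of_coord_eq fun i => ?_
    rw [Function.Embedding.trans_apply, Function.Embedding.trans_apply, Equiv.coe_toEmbedding, Equiv.coe_toEmbedding, heN,
      hφ₁, he', Fin.coe_succEmb, Fin.val_succ]
    push_cast
    ring
  have hcast : (Fin.castSuccEmb : Fin (n + 2) ↪ Fin (n + 3)).trans eN.toEmbedding =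
      e'.toEmbedding.trans (PolySite.incl (chainWindow_mono_right (-1) (by omega : (n : ℤ) ≤ n + 1))) := by
    refine embedding_eq_of_coord_eq fun i => ?_
    rw [Function.Embedding.trans_apply, Function.Embedding.trans_apply, Equiv.coe_toEmbedding, Equiv.coe_toEmbedding, heN,
      hφ₀, he', Fin.coe_castSuccEmb, Fin.val_castSucc, add_zero]
  have hFLTI : spinPartialTrace (Fin.succEmb (n + 2)) ρF = spinPartialTrace Fin.castSuccEmb ρF := by
    rw [hρFdef, ← spinPartialTrace_trans, ← spinPartialTrace_trans, hsucc, hcast, spinPartialTrace_trans e'.toEmbedding,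
      spinPartialTrace_trans e'.toEmbedding, hLTI]
  have hFsecN : ∀ k k' : TensorIndex (Fin (n + 3)) 4,
      (∑ x, (siteOcc (k x)).card) ≠ (∑ x, (siteOcc (k' x)).card) → ρF k k' = 0 :=
    fun k k' h => spinPartialTrace_apply_eq_zero_of_charge (fun s : Fin 4 => (siteOcc s).card) eN.toEmbedding hsec h
  -- staggered-spin sectors of `ρ^F`: the big window's parity sign read at position `i` is `-(-1)^i` (coordinate `i - 1`)
  have hsign : ∀ i : Fin (n + 3), (if Odd (ofLex (eN i).1 0) then (-1 : ℤ) else 1) = -((-1 : ℤ) ^ (i : ℕ)) := by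
    intro i
    rw [heN]
    rcases Nat.even_or_odd (i : ℕ) with h | h
    · rw [h.neg_one_pow, if_pos]
      rcases h with ⟨r, hr⟩
      exact ⟨(r : ℤ) - 1, by omega⟩
    · rw [h.neg_one_pow, neg_neg, if_neg]
      rcases h with ⟨r, hr⟩
      rintro ⟨r', hr'⟩
      omega
  -- the two scalar charges of a configuration of the relabelled window
  have hpair : ∀ w : TensorIndex (Fin (n + 3)) 4, (∑ x : Fin (n + 3), qs (x : ℕ) (w x)) =
      (∑ x : Fin (n + 3), (fun s : Fin 4 => cb * ((siteOcc s).card : ℤ) - ca) (w x),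
        (-cm) * ∑ i : Fin (n + 3), (-((-1 : ℤ) ^ (i : ℕ))) *
          ((if (0 : Fin 2) ∈ siteOcc (w i) then 1 else 0 : ℤ) - (if (1 : Fin 2) ∈ siteOcc (w i) then 1 else 0 : ℤ))) := by
    intro w
    rw [Prod.ext_iff, Prod.fst_sum, Prod.snd_sum, Finset.mul_sum]
    refine ⟨Finset.sum_congr rfl fun x _ => by rw [hqs], Finset.sum_congr rfl fun x _ => by rw [hqs]; ring⟩
  have hFstag : ∀ u v : TensorIndex (Fin (n + 3)) 4,
      (∑ i : Fin (n + 3), (-((-1 : ℤ) ^ (i : ℕ))) *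
          ((if (0 : Fin 2) ∈ siteOcc (u i) then 1 else 0 : ℤ) - (if (1 : Fin 2) ∈ siteOcc (u i) then 1 else 0 : ℤ))) ≠
        (∑ i : Fin (n + 3), (-((-1 : ℤ) ^ (i : ℕ))) *
          ((if (0 : Fin 2) ∈ siteOcc (v i) then 1 else 0 : ℤ) - (if (1 : Fin 2) ∈ siteOcc (v i) then 1 else 0 : ℤ))) →
      ρF u v = 0 := by
    intro u v huv
    refine spinPartialTrace_apply_eq_zero_of_chargeAt
      (fun (y : PolySite (chainWindow (-1) ((n : ℤ) + 1))) (s : Fin 4) => (if Odd (ofLex y.1 0) then (-1 : ℤ) else 1) *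
        ((if (0 : Fin 2) ∈ siteOcc s then 1 else 0 : ℤ) - (if (1 : Fin 2) ∈ siteOcc s then 1 else 0 : ℤ)))
      eN.toEmbedding hstag ?_
    simpa only [Equiv.coe_toEmbedding, hsign] using huv
  have hFsec : ∀ u v : TensorIndex (Fin (n + 3)) 4,
      (∑ x : Fin (n + 3), qs (x : ℕ) (u x)) ≠ (∑ x : Fin (n + 3), qs (x : ℕ) (v x)) → ρF u v = 0 := by
    intro u v huv
    by_contra hne
    apply huv
    have h0 : (∑ x, (fun s : Fin 4 => cb * ((siteOcc s).card : ℤ) - ca) (u x)) =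
        ∑ x, (fun s : Fin 4 => cb * ((siteOcc s).card : ℤ) - ca) (v x) := by
      by_contra h
      exact hne (apply_eq_zero_of_sum_srotCharge_ne cb ca hFsecN u v h)
    have h1 : (∑ i : Fin (n + 3), (-((-1 : ℤ) ^ (i : ℕ))) *
          ((if (0 : Fin 2) ∈ siteOcc (u i) then 1 else 0 : ℤ) - (if (1 : Fin 2) ∈ siteOcc (u i) then 1 else 0 : ℤ))) =
        ∑ i : Fin (n + 3), (-((-1 : ℤ) ^ (i : ℕ))) *
          ((if (0 : Fin 2) ∈ siteOcc (v i) then 1 else 0 : ℤ) - (if (1 : Fin 2) ∈ siteOcc (v i) then 1 else 0 : ℤ)) := by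
      by_contra h
      exact hne (hFstag u v h)
    rw [hpair, hpair, h0, h1]
  have hFstar : ∀ u v, star (ρF u v) = ρF u v := fun u v => by
    have := conj_spinPartialTrace_apply eN.toEmbedding hreal u v
    rwa [starRingEnd_apply] at this
  -- (ii) the model-independent core: KSDN's `ω_m = C_{m−2}(ρ^F|_{first m})`
  obtain ⟨ω, hE4L, hE4R, hEmL, hEmR, hωpsd, hωsec, hωreal, hωbd, hωtr⟩ :=
    exists_mpsRawRowsTr_of_window_loewner_at 4 (n + 1) (by norm_num) (show 4 ≤ n + 1 by omega) A hAreal qs qb hAcov B hB ρF hFpsd hFtr hFLTI hFsec hFstar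
  -- (iii) the five-site marginal `ρ₅` and its rows
  set ρ₅ : Op (PolySite (chainWindow (-1) 3)) 4 := spinPartialTrace (PolySite.incl hW5) ρ with hρ₅def
  have h5psd : ρ₅.PosSemidef := posSemidef_spinPartialTrace _ hpsd
  have h5tr : ρ₅.trace = 1 := by rw [hρ₅def, trace_spinPartialTrace, htr]
  have h5LTI : spinPartialTrace ((PolySite.affEmb 1 (unitVec 0) (chainWindow (-1) 2)).trans
        (PolySite.incl affShiftSet_chainWindow_two_subset_three)) ρ₅ =
      spinPartialTrace (PolySite.incl chainWindow_two_subset_three) ρ₅ := by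
    rw [hρ₅def, ← spinPartialTrace_trans, ← spinPartialTrace_trans]
    refine spinPartialTrace_eq_of_shift hφ₀ hφ₁ hLTI 1 ?_ ?_
    · intro y
      rw [shift_trans (shift_affEmb_trans_incl (unitVec (0 : Fin 1)) affShiftSet_chainWindow_two_subset_three)
        (shift_incl hW5), chain_unitVec_apply_zero]
      push_cast
      ring
    · intro y
      rw [shift_trans (shift_incl chainWindow_two_subset_three) (shift_incl hW5), add_zero]
  have h5sec : ∀ k k' : TensorIndex (PolySite (chainWindow (-1) 3)) 4,
      (∑ x, (siteOcc (k x)).card) ≠ (∑ x, (siteOcc (k' x)).card) → ρ₅ k k' = 0 :=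
    fun k k' h => spinPartialTrace_apply_eq_zero_of_charge (fun s : Fin 4 => (siteOcc s).card) (PolySite.incl hW5) hsec h
  have h5stag : ∀ k k' : TensorIndex (PolySite (chainWindow (-1) 3)) 4,
      (∑ y : PolySite (chainWindow (-1) 3), (if Odd (ofLex y.1 0) then (-1 : ℤ) else 1) *
          ((if (0 : Fin 2) ∈ siteOcc (k y) then 1 else 0 : ℤ) - (if (1 : Fin 2) ∈ siteOcc (k y) then 1 else 0 : ℤ))) ≠
        (∑ y : PolySite (chainWindow (-1) 3), (if Odd (ofLex y.1 0) then (-1 : ℤ) else 1) *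
          ((if (0 : Fin 2) ∈ siteOcc (k' y) then 1 else 0 : ℤ) - (if (1 : Fin 2) ∈ siteOcc (k' y) then 1 else 0 : ℤ))) →
      ρ₅ k k' = 0 := by
    intro k k' h
    refine spinPartialTrace_apply_eq_zero_of_chargeAt
      (fun (y : PolySite (chainWindow (-1) ((n : ℤ) + 1))) (s : Fin 4) => (if Odd (ofLex y.1 0) then (-1 : ℤ) else 1) *
        ((if (0 : Fin 2) ∈ siteOcc s then 1 else 0 : ℤ) - (if (1 : Fin 2) ∈ siteOcc s then 1 else 0 : ℤ)))
      (PolySite.incl hW5) hstag ?_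
    exact h
  have h5dens : ((toSpin (nAt (-unitVec 0) neg_unitVec_mem_chainWindow_three 0 +
      nAt (-unitVec 0) neg_unitVec_mem_chainWindow_three 1) * ρ₅).trace).re = ν := by
    rw [hρ₅def, trace_toSpin_mul_spinPartialTrace_incl hW5 hlow5, fermionEmbed_add, fermionEmbed_incl_nAt,
      fermionEmbed_incl_nAt]
    exact hdens
  have h5real : ∀ k k' : TensorIndex (PolySite (chainWindow (-1) 3)) 4, starRingEnd ℂ (ρ₅ k k') = ρ₅ k k' :=
    fun k k' => conj_spinPartialTrace_apply (PolySite.incl hW5) hreal k k'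
  have h5bd : ∀ k k' : TensorIndex (PolySite (chainWindow (-1) 3)) 4, ‖ρ₅ k k'‖ ≤ 1 :=
    norm_apply_le_one_of_posSemidef h5psd h5tr
  -- `ρ^F|_{first 5}` is `ρ₅` read through `e₅`
  have hemb : (Fin.castLEEmb (show 4 + 1 ≤ n + 3 by omega)).trans eN.toEmbedding =
      e₅.toEmbedding.trans (PolySite.incl hW5) := by
    refine embedding_eq_of_coord_eq fun i => ?_
    rw [Function.Embedding.trans_apply, Function.Embedding.trans_apply, Equiv.coe_toEmbedding, Equiv.coe_toEmbedding, heN,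
      Fin.castLEEmb_apply, Fin.val_castLE]
    change _ = ofLex (e₅ i).1 0
    rw [he₅]
  have hlink : headMarginal (show 4 + 1 ≤ n + 1 + 2 by omega) ρF =
      ρ₅.submatrix (Equiv.arrowCongr e₅ (Equiv.refl (Fin 4))) (Equiv.arrowCongr e₅ (Equiv.refl (Fin 4))) := by
    rw [headMarginal, hρFdef, ← spinPartialTrace_trans, hemb, spinPartialTrace_trans, spinPartialTrace_equiv]
    ext u v
    rw [reindexOp_apply, Matrix.submatrix_apply]
    rfl
  rw [hlink] at hE4L hE4R
  -- (iv) apply the `mps` claim and move the objective back to the big window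
  have hE := hclaim ρ₅ ω h5psd h5tr h5LTI h5sec h5stag h5dens h5real h5bd hE4L hE4R hEmL hEmR hωpsd hωsec hωreal hωbd hωtr
  rw [hρ₅def, trace_toSpin_mul_spinPartialTrace_incl hW5 hlow5] at hE
  simp only [fermionEmbed_add, fermionEmbed_smul, fermionEmbed_sum, fermionEmbed_mul, fermionEmbed_conjTranspose,
    fermionEmbed_incl_nAt, fermionEmbed_incl_cAt] at hE
  exact hE

end Transport

end Summit.Ventures.CertifiedManyBodySolver.Transport

end
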